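import Summits.CriticalPhenomena.PercolationContinuityZ3.Theorems.PercNearOneGluingNoHeavyLowerTailChampionStability
import Summits.CriticalPhenomena.PercolationContinuityZ3.Theorems.PercNearOneGluingNoHeavyLowerTailMergeLemmaTwo
import Summits.CriticalPhenomena.PercolationContinuityZ3.Theorems.PercNearOneGluingAdditiveGluingOneBond
import Literature.Probability.LatticeModels.ProdBernoulliAtomExpansion
import Literature.Probability.Percolation.KozmaNitzanPinning
import HarnessLib

/-!
# `NoHeavyLowerTail` (stmt-CriticalPhenomena-4575), cumulative-isolation line — gluing lemmas for observers
# with relay-only neighbourhoods (part 1 of 3: `RelayNbhd` toolbox)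

Bond percolation on `Fin n` (`μ = prodBernoulli w`).  For an observer `o`, pinning the non-loop pairs at `o`
closed (`pinW w {e | o ∈ e ∧ ¬ e.IsDiag} ∅`, the tree's `pinW`) is the graph `G − o`.  This file collects the
plumbing used by `…RelayNeighbourhoodBase.lean` / `…RelayNeighbourhood.lean`: invariance of `G − o` under
updating a pair at `o`; "no open pair at `o`" is almost sure under the pinned law; reachability after
opening one pair `s(o,x)` in a configuration where `o` is isolated (`reachable_insert_iff_of_isolated`,
`reachable_o_insert_iff_of_isolated`, from the tree's `ChampionStability.reachable_insert_iff`); and the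
transport formulas `μ_{w⁰[ox↦1]}(S) = μ_{w⁰}((insert ox)⁻¹ S)`,
`μ_{w⁰[ox↦1][oy↦1]}(S) = μ_{w⁰}((insert oy ∘ insert ox)⁻¹ S)` (`tieLiftOne_real_one_eq`).  All folklore.
-/

namespace Summit.CriticalPhenomena.PercolationContinuityZ3.Theorems

open MeasureTheory Set Literature.Probability.LatticeModels Literature.Probability.Percolation
open scoped Classical BigOperators

variable {n : ℕ}

namespace RelayNbhd

/-- Pinning the (non-loop) pairs at `o` closed, `pinW w {e | o ∈ e ∧ ¬ e.IsDiag} ∅`, is the graph `G − o`;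
the pinned weight of `s(o,v)`, `v ≠ o`, is `0`. [folklore] -/
theorem pinW_star_mk (w : Sym2 (Fin n) → unitInterval) {o v : Fin n} (h : v ≠ o) :
    pinW w {e : Sym2 (Fin n) | o ∈ e ∧ ¬ e.IsDiag} ∅ s(o, v) = 0 := by
  have hmem : s(o, v) ∈ {e : Sym2 (Fin n) | o ∈ e ∧ ¬ e.IsDiag} :=
    ⟨Sym2.mem_mk_left o v, by rw [Sym2.mk_isDiag_iff]; exact h.symm⟩
  exact pinW_apply_of_mem_of_not_mem w hmem (Set.notMem_empty _)

/-- Updating a non-loop pair at `o` does not change `G − o`. [folklore] -/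
theorem pinW_star_update (w : Sym2 (Fin n) → unitInterval) {o v : Fin n} (hv : v ≠ o) (c : unitInterval) :
    pinW (Function.update w s(o, v) c) {e : Sym2 (Fin n) | o ∈ e ∧ ¬ e.IsDiag} ∅ =
      pinW w {e : Sym2 (Fin n) | o ∈ e ∧ ¬ e.IsDiag} ∅ := by
  funext e
  rw [pinW_apply, pinW_apply]
  by_cases h : e ∈ {e : Sym2 (Fin n) | o ∈ e ∧ ¬ e.IsDiag}
  · rw [if_pos h, if_pos h]
  · have hne : e ≠ s(o, v) := by
      intro he; apply h; rw [he]
      exact ⟨Sym2.mem_mk_left o v, by rw [Sym2.mk_isDiag_iff]; exact hv.symm⟩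
    rw [if_neg h, if_neg h, Function.update_of_ne hne]

/-- In a configuration with no open pair at `o`, `o` reaches only itself. [folklore] -/
theorem eq_of_reachable_of_isolated {ω : BondConfig (Fin n)} {o u : Fin n}
    (hiso : ∀ v : Fin n, v ≠ o → s(o, v) ∉ ω) (h : (openGraph ω).Reachable o u) : u = o := by
  obtain ⟨p⟩ := h
  cases p with
  | nil => rfl
  | cons hadj _ =>
    rw [openGraph_adj] at hadj
    exact absurd hadj.1 (hiso _ (Ne.symm hadj.2))

/-- The event "no open pair at `o`" is almost sure under `pinW w {pairs at o} ∅` (`G − o`). [folklore] -/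
theorem real_compl_isolated_eq_zero (w : Sym2 (Fin n) → unitInterval) (o : Fin n) :
    (prodBernoulli (pinW w {e : Sym2 (Fin n) | o ∈ e ∧ ¬ e.IsDiag} ∅)).real {ω : BondConfig (Fin n) | ∀ v : Fin n, v ≠ o → s(o, v) ∉ ω}ᶜ = 0 := by
  set F : Finset (Sym2 (Fin n)) :=
    ((Finset.univ : Finset (Fin n)).filter (fun v => v ≠ o)).image (fun v => s(o, v)) with hF
  have hsub : {ω : BondConfig (Fin n) | ∀ v : Fin n, v ≠ o → s(o, v) ∉ ω}ᶜ ⊆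
      {ω : BondConfig (Fin n) | ∃ e ∈ F, e ∈ ω} := by
    intro ω hω
    simp only [Set.mem_compl_iff, Set.mem_setOf_eq, not_forall, not_not] at hω
    obtain ⟨v, hv, hmem⟩ := hω
    exact ⟨s(o, v), Finset.mem_image.2 ⟨v, Finset.mem_filter.2 ⟨Finset.mem_univ _, hv⟩, rfl⟩, hmem⟩
  have h0 : prodBernoulli (pinW w {e : Sym2 (Fin n) | o ∈ e ∧ ¬ e.IsDiag} ∅) {ω : BondConfig (Fin n) | ∃ e ∈ F, e ∈ ω} = 0 := by
    refine prodBernoulli_setOf_exists_mem_eq_zero (pinW w {e : Sym2 (Fin n) | o ∈ e ∧ ¬ e.IsDiag} ∅) F fun e he => ?_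
    obtain ⟨v, hv, rfl⟩ := Finset.mem_image.1 he
    rw [pinW_star_mk w (Finset.mem_filter.1 hv).2]
    rfl
  have h0' : (prodBernoulli (pinW w {e : Sym2 (Fin n) | o ∈ e ∧ ¬ e.IsDiag} ∅)).real {ω : BondConfig (Fin n) | ∃ e ∈ F, e ∈ ω} = 0 := by
    rw [measureReal_def, h0, ENNReal.toReal_zero]
  exact le_antisymm ((measureReal_mono hsub).trans h0'.le) measureReal_nonneg

/-- Restricting to an almost sure event does not lose probability. [folklore] -/
theorem real_le_real_inter_of_null (μ : Measure (BondConfig (Fin n))) [IsFiniteMeasure μ]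
    (S Z : Set (BondConfig (Fin n))) (hZ : μ.real Zᶜ = 0) : μ.real S ≤ μ.real (S ∩ Z) := by
  have hsub : S ⊆ (S ∩ Z) ∪ Zᶜ := by
    intro ω hω
    by_cases hz : ω ∈ Z
    · exact Or.inl ⟨hω, hz⟩
    · exact Or.inr hz
  calc μ.real S ≤ μ.real ((S ∩ Z) ∪ Zᶜ) := measureReal_mono hsub
    _ ≤ μ.real (S ∩ Z) + μ.real Zᶜ := measureReal_union_le _ _
    _ = μ.real (S ∩ Z) := by rw [hZ, add_zero]

/-- After opening `s(o,x)` in a configuration where `o` is isolated, a vertex `c ≠ o` reaches `u ≠ o`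
iff it did before, possibly through `x`. [folklore] -/
theorem reachable_insert_iff_of_isolated {ω : BondConfig (Fin n)} {o x c u : Fin n} (hox : o ≠ x)
    (hiso : ∀ v : Fin n, v ≠ o → s(o, v) ∉ ω) (hco : c ≠ o) (huo : u ≠ o) :
    (openGraph (insert s(o, x) ω)).Reachable c u ↔
      ((openGraph ω).Reachable c u ∨ ((openGraph ω).Reachable c x ∧ (openGraph ω).Reachable x u)) := by
  rw [ChampionStability.reachable_insert_iff ω hox]
  constructor
  · rintro (h | ⟨⟨s, hs, hcs⟩, ⟨s', hs', hsu⟩⟩)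
    · exact Or.inl h
    · simp only [Finset.mem_insert, Finset.mem_singleton] at hs hs'
      rcases hs with rfl | rfl
      · exact absurd (eq_of_reachable_of_isolated hiso hcs.symm) hco
      rcases hs' with rfl | rfl
      · exact absurd (eq_of_reachable_of_isolated hiso hsu) huo
      · exact Or.inr ⟨hcs, hsu⟩
  · rintro (h | ⟨h1, h2⟩)
    · exact Or.inl h
    · exact Or.inr ⟨⟨x, by simp, h1⟩, ⟨x, by simp, h2⟩⟩

/-- After opening `s(o,x)` (with `o` isolated before): `o ↔ u` iff `x ↔ u`, for `u ≠ o`. [folklore] -/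
theorem reachable_o_insert_iff_of_isolated {ω : BondConfig (Fin n)} {o x u : Fin n} (hox : o ≠ x)
    (hiso : ∀ v : Fin n, v ≠ o → s(o, v) ∉ ω) (huo : u ≠ o) :
    (openGraph (insert s(o, x) ω)).Reachable o u ↔ (openGraph ω).Reachable x u := by
  rw [ChampionStability.reachable_insert_left_iff ω hox]
  constructor
  · rintro (h | h)
    · exact absurd (eq_of_reachable_of_isolated hiso h) huo
    · exact h
  · exact fun h => Or.inr h

/-- `μ_{w⁰[s(o,x) ↦ 1]}(S) = μ_{w⁰}((insert s(o,x))⁻¹ S)` for `w⁰ = pinW w {e : Sym2 (Fin n) | o ∈ e ∧ ¬ e.IsDiag} ∅`, `x ≠ o`. [folklore] -/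
theorem real_update_wzero_one (w : Sym2 (Fin n) → unitInterval) {o x : Fin n} (hx : x ≠ o)
    (S : Set (BondConfig (Fin n))) :
    (prodBernoulli (Function.update (pinW w {e : Sym2 (Fin n) | o ∈ e ∧ ¬ e.IsDiag} ∅) s(o, x) 1)).real S =
      (prodBernoulli (pinW w {e : Sym2 (Fin n) | o ∈ e ∧ ¬ e.IsDiag} ∅)).real ((fun ω : BondConfig (Fin n) => insert s(o, x) ω) ⁻¹' S) := by
  rw [tieLiftOne_real_one_eq]
  have h0 : Function.update (pinW w {e : Sym2 (Fin n) | o ∈ e ∧ ¬ e.IsDiag} ∅) s(o, x) 0 = pinW w {e : Sym2 (Fin n) | o ∈ e ∧ ¬ e.IsDiag} ∅ := by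
    rw [Function.update_eq_self_iff]; exact (pinW_star_mk w hx).symm
  rw [h0]

/-- Two gluings: `μ_{w⁰[ox ↦ 1][oy ↦ 1]}(S) = μ_{w⁰}({ω | insert oy (insert ox ω) ∈ S})`. [folklore] -/
theorem real_update_wzero_one_one (w : Sym2 (Fin n) → unitInterval) {o x y : Fin n} (hx : x ≠ o)
    (hy : y ≠ o) (hxy : x ≠ y) (S : Set (BondConfig (Fin n))) :
    (prodBernoulli (Function.update (Function.update (pinW w {e : Sym2 (Fin n) | o ∈ e ∧ ¬ e.IsDiag} ∅) s(o, x) 1) s(o, y) 1)).real S =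
      (prodBernoulli (pinW w {e : Sym2 (Fin n) | o ∈ e ∧ ¬ e.IsDiag} ∅)).real
        {ω : BondConfig (Fin n) | insert s(o, y) (insert s(o, x) ω) ∈ S} := by
  rw [tieLiftOne_real_one_eq]
  have hne : s(o, y) ≠ s(o, x) := fun h => hxy (Sym2.congr_right.1 h).symm
  have h0 : Function.update (Function.update (pinW w {e : Sym2 (Fin n) | o ∈ e ∧ ¬ e.IsDiag} ∅) s(o, x) 1) s(o, y) 0 =
      Function.update (pinW w {e : Sym2 (Fin n) | o ∈ e ∧ ¬ e.IsDiag} ∅) s(o, x) 1 := by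
    rw [Function.update_eq_self_iff, Function.update_of_ne hne]
    exact (pinW_star_mk w hy).symm
  rw [h0, real_update_wzero_one w hx]
  rfl

end RelayNbhd

end Summit.CriticalPhenomena.PercolationContinuityZ3.Theorems
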